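import Summits.QuantumFields.GaugeBoot.FreeSubgroupSU2
import HarnessLib

/-!
# A free subgroup of `SU(2)` of countably infinite rank: `n ↦ A^{n+1} B A^{n+1}` (gauge-boot, large-`N` supplement 16, part 1b)

HONEST FRAMING (cell `pub-gaugeboot`, page 1 of every file): the venture produces certified bounds
on lattice expectations at stated coupling, gauge group, dimension and torus size; NOT a mass gap,
NOT a continuum limit, NOT a string tension; NOT large `N` unless marked CONDITIONAL; NOT
Yang–Mills-summit-bearing (barriers `FixedCouplingUltralocality`, `PerturbativeInvisibility`).
Pure group theory; this file certifies no number.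

## Content

With `A, B ∈ SU(2)` the rational free pair of `FreeSubgroupSU2.lean`:

* `FreeSU2.genNat n = A^{n+1} B A^{n+1}`; ★★ `FreeSU2.prod_valNat_ne_one` — no non-empty reduced word in
  the `g_n^{±1}` is the identity; ★★ `FreeSU2.lift_genNat_injective` — the homomorphism
  `FreeGroup ℕ →* SU(2)`, `n ↦ g_n`, is INJECTIVE: **`SU(2)` contains a free group of countably infinite
  rank** (part 2 uses one generator per lattice axis); `prod_valNat_eq_one_iff`,
  `eq_of_prod_valNat_eq` (reduced words with the same value are equal).

## Proof

A reduced word in the `g_n^{±1}` is regrouped (`altData`, `prod_valNat_eq_altVal`) into an alternating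
word `A^{e₀} B^{±1} A^{e₁} ⋯ B^{±1} A^{e_k}`, `k ≥ 1`, whose inner exponents
`e_i = ±(n_i+1) ± (n_{i+1}+1)` vanish only at a backtrack (`altData_isChain`); the letter-by-letter
spelling of such a word (`altMicro`) is a non-empty REDUCED word in `A^{±1}, B^{±1}`
(`isReduced_altMicro`), so `FreeSU2.prod_lval_ne_one` applies.  [folklore] (subgroups of free groups;
Hausdorff 1914, Lubotzky–Phillips–Sarnak 1986 for the pair `A, B`).
-/

noncomputable section

open Matrix

namespace Summit.QuantumFields.GaugeBoot

namespace FreeSU2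

/-! ## Countably infinite rank: `n ↦ A^{n+1} B A^{n+1}` -/

/-- The `n`-th generator of infinite rank: `g_n = A^{n+1} B A^{n+1}`. [folklore] -/
def genNat (n : ℕ) : SU 2 := genA ^ (n + 1) * genB * genA ^ (n + 1)

/-- Value of a letter of `FreeGroup ℕ`: `g_n` or `g_n⁻¹`. [folklore] -/
def valNat (p : ℕ × Bool) : SU 2 := cond p.2 (genNat p.1) (genNat p.1)⁻¹

/-- The signed exponent `±m`. [folklore] -/
def sgnExp (s : Bool) (m : ℕ) : ℤ := cond s (m : ℤ) (-(m : ℤ))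

/-- **Alternating data** of a word in the `g_n^{±1}`: the leading `A`-exponent and the list of
(`B`-sign, following `A`-exponent), adjacent `A`-powers merged. [folklore] -/
def altData : List (ℕ × Bool) → ℤ × List (Bool × ℤ)
  | [] => (0, [])
  | (n, s) :: W => (sgnExp s (n + 1), (s, sgnExp s (n + 1) + (altData W).1) :: (altData W).2)

/-- The alternating product `A^{e₀} B^{ε₁} A^{e₁} ⋯ B^{ε_k} A^{e_k}`. [folklore] -/
def altVal : ℤ → List (Bool × ℤ) → SU 2
  | e, [] => genA ^ e
  | e, (ε, e') :: bl => genA ^ e * cond ε genB genB⁻¹ * altVal e' bl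

/-- Merging a leading `A`-power into the alternating product. [folklore] -/
theorem zpow_mul_altVal (p q : ℤ) : ∀ bl, genA ^ p * altVal q bl = altVal (p + q) bl
  | [] => by rw [altVal, altVal, _root_.zpow_add]
  | (ε, e) :: bl => by rw [altVal, altVal, _root_.zpow_add, mul_assoc, mul_assoc, mul_assoc]

/-- `g_n^{±1} = A^{±(n+1)} B^{±1} A^{±(n+1)}`. [folklore] -/
theorem valNat_eq (n : ℕ) (s : Bool) :
    valNat (n, s) = genA ^ sgnExp s (n + 1) * cond s genB genB⁻¹ * genA ^ sgnExp s (n + 1) := by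
  cases s
  · show (genA ^ (n + 1) * genB * genA ^ (n + 1))⁻¹ = genA ^ (-((n + 1 : ℕ) : ℤ)) * genB⁻¹ * genA ^ (-((n + 1 : ℕ) : ℤ))
    rw [_root_.zpow_neg, zpow_natCast, _root_.mul_inv_rev, _root_.mul_inv_rev, mul_assoc]
  · show genA ^ (n + 1) * genB * genA ^ (n + 1) = genA ^ ((n + 1 : ℕ) : ℤ) * genB * genA ^ ((n + 1 : ℕ) : ℤ)
    rw [zpow_natCast]

/-- **Regrouping**: the product of a word in the `g_n^{±1}` is the alternating product of its
alternating data. [folklore] -/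
theorem prod_valNat_eq_altVal : ∀ W : List (ℕ × Bool), (W.map valNat).prod = altVal (altData W).1 (altData W).2
  | [] => by simp [altData, altVal]
  | (n, s) :: W => by
    rw [List.map_cons, List.prod_cons, prod_valNat_eq_altVal W, valNat_eq]
    simp only [altData, altVal]
    rw [mul_assoc, zpow_mul_altVal]

/-- The `A`-block of an integer exponent: `|e|` copies of `A` (`e ≥ 0`) or of `A⁻¹` (`e < 0`). [folklore] -/
def ablock (e : ℤ) : List Letter := List.replicate e.natAbs (0, decide (0 ≤ e))

/-- The micro-word (in `A^{±1}, B^{±1}`) of alternating data. [folklore] -/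
def altMicro : ℤ → List (Bool × ℤ) → List Letter
  | e, [] => ablock e
  | e, (ε, e') :: bl => ablock e ++ (1, ε) :: altMicro e' bl

/-- The `A`-block evaluates to `A^e`. [folklore] -/
theorem prod_lval_ablock (e : ℤ) : ((ablock e).map lval).prod = genA ^ e := by
  rw [ablock, List.map_replicate, List.prod_replicate]
  by_cases h0 : 0 ≤ e
  · rw [decide_eq_true h0]
    conv_rhs => rw [← Int.natAbs_of_nonneg h0, zpow_natCast]
    rfl
  · rw [decide_eq_false h0]
    have he : e = -(e.natAbs : ℤ) := by omega
    conv_rhs => rw [he, _root_.zpow_neg, zpow_natCast, ← inv_pow]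
    rfl

/-- The micro-word evaluates to the alternating product. [folklore] -/
theorem prod_lval_altMicro : ∀ (e : ℤ) (bl : List (Bool × ℤ)), ((altMicro e bl).map lval).prod = altVal e bl
  | e, [] => by rw [altMicro, altVal, prod_lval_ablock]
  | e, (ε, e') :: bl => by
    rw [altMicro, altVal, List.map_append, List.prod_append, List.map_cons, List.prod_cons, prod_lval_ablock,
      prod_lval_altMicro e' bl, mul_assoc]
    cases ε <;> rfl

/-- The `A`-block is a reduced word. [folklore] -/
theorem isReduced_ablock (e : ℤ) : FreeGroup.IsReduced (ablock e) :=
  List.isChain_replicate_of_rel _ (fun _ => rfl)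

/-- The last letter of an `A`-block (if any) is an `A`-letter. [folklore] -/
theorem fst_eq_zero_of_mem_ablock {e : ℤ} {x : Letter} (hx : x ∈ ablock e) : x.1 = 0 := by
  rw [ablock, List.mem_replicate] at hx
  rw [hx.2]

/-- The head of a micro-word with non-zero leading exponent is an `A`-letter; with zero leading
exponent it is the first `B`-letter. [folklore] -/
theorem head?_altMicro (e : ℤ) (bl : List (Bool × ℤ)) :
    ∀ y ∈ (altMicro e bl).head?, y.1 = 0 ∨ (e = 0 ∧ ∃ h : bl ≠ [], y = (1, (bl.head h).1)) := by
  intro y hy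
  cases bl with
  | nil =>
    rw [altMicro] at hy
    exact Or.inl (fst_eq_zero_of_mem_ablock (List.mem_of_mem_head? hy))
  | cons p bl =>
    obtain ⟨ε, e'⟩ := p
    rw [altMicro] at hy
    by_cases he : e = 0
    · subst he
      simp [ablock] at hy
      exact Or.inr ⟨rfl, List.cons_ne_nil _ _, by simp [← hy]⟩
    · have hne : ablock e ≠ [] := by
        rw [ablock, Ne, List.replicate_eq_nil_iff]; omega
      rw [List.head?_append_of_ne_nil _ hne] at hy
      exact Or.inl (fst_eq_zero_of_mem_ablock (List.mem_of_mem_head? hy))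

/-- **The micro-word of admissible alternating data is reduced**: it suffices that every inner
exponent is non-zero or the two `B`-signs around it agree. [folklore] -/
theorem isReduced_altMicro : ∀ (e : ℤ) (bl : List (Bool × ℤ)),
    bl.IsChain (fun p q => p.2 ≠ 0 ∨ p.1 = q.1) → FreeGroup.IsReduced (altMicro e bl)
  | e, [], _ => isReduced_ablock e
  | e, (ε, e') :: bl, h => by
    rw [altMicro]
    have htail : FreeGroup.IsReduced (altMicro e' bl) := isReduced_altMicro e' bl (List.isChain_cons.1 h).2
    have hcons : FreeGroup.IsReduced ((1, ε) :: altMicro e' bl) := by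
      refine List.isChain_cons.2 ⟨fun y hy => ?_, htail⟩
      rcases head?_altMicro e' bl y hy with hy0 | ⟨he0, hbl, rfl⟩
      · intro h1; exact absurd (h1.trans hy0) one_ne_zero
      · intro _
        have hmem : bl.head hbl ∈ bl.head? := by
          cases bl with
          | nil => exact absurd rfl hbl
          | cons p bl => simp
        have hrel := (List.isChain_cons.1 h).1 (bl.head hbl) hmem
        rcases hrel with hne | heq
        · exact absurd he0 hne
        · exact heq
    refine List.IsChain.append (isReduced_ablock e) hcons fun x hx y hy => ?_
    rw [List.head?_cons, Option.mem_some_iff] at hy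
    subst hy
    intro h1
    exact absurd ((fst_eq_zero_of_mem_ablock (List.mem_of_mem_getLast? hx)).symm.trans h1) zero_ne_one

/-- A micro-word with at least one `B`-letter is non-empty. [folklore] -/
theorem altMicro_ne_nil (e : ℤ) {bl : List (Bool × ℤ)} (hbl : bl ≠ []) : altMicro e bl ≠ [] := by
  obtain ⟨⟨ε, e'⟩, bl, rfl⟩ := List.exists_cons_of_ne_nil hbl
  rw [altMicro]; simp

/-- The alternating data of a non-empty word has a `B`-letter. [folklore] -/
theorem altData_snd_ne_nil : ∀ {W : List (ℕ × Bool)}, W ≠ [] → (altData W).2 ≠ []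
  | [], h => absurd rfl h
  | (n, s) :: W, _ => by rw [altData]; exact List.cons_ne_nil _ _

/-- The leading exponent of the alternating data of `(n,s) :: W` is `±(n+1)`. [folklore] -/
theorem altData_fst_cons (n : ℕ) (s : Bool) (W : List (ℕ × Bool)) : (altData ((n, s) :: W)).1 = sgnExp s (n + 1) := rfl

/-- **Inner exponents vanish only at a backtrack**: the alternating data of a REDUCED word in the
`g_n^{±1}` is admissible. [folklore] -/
theorem altData_isChain : ∀ (W : List (ℕ × Bool)), FreeGroup.IsReduced W →
    (altData W).2.IsChain (fun p q => p.2 ≠ 0 ∨ p.1 = q.1)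
  | [], _ => List.IsChain.nil
  | [(n, s)], _ => by rw [altData]; exact List.isChain_singleton _
  | (n, s) :: (n', s') :: W, h => by
    obtain ⟨hred, h'⟩ := FreeGroup.isReduced_cons_cons.1 h
    have ih := altData_isChain ((n', s') :: W) h'
    rw [altData]
    rw [altData] at ih ⊢
    refine List.IsChain.cons ih ?_
    intro q hq
    simp only [List.head?_cons, Option.mem_some_iff] at hq
    subst hq
    by_cases hs : s = s'
    · exact Or.inr hs
    · left
      have hn : n ≠ n' := fun hnn => hs (hred hnn)
      show sgnExp s (n + 1) + sgnExp s' (n' + 1) ≠ 0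
      cases s <;> cases s' <;> simp [sgnExp] at hs ⊢ <;> omega

/-- ★★ **No non-empty reduced word in the `g_n = A^{n+1} B A^{n+1}` is the identity.** [folklore] -/
theorem prod_valNat_ne_one {W : List (ℕ × Bool)} (hW : W ≠ []) (h : FreeGroup.IsReduced W) : (W.map valNat).prod ≠ 1 := by
  rw [prod_valNat_eq_altVal, ← prod_lval_altMicro]
  exact prod_lval_ne_one (altMicro_ne_nil _ (altData_snd_ne_nil hW)) (isReduced_altMicro _ _ (altData_isChain W h))

/-- ★★ **`SU(2)` contains a free group of countably infinite rank**: the homomorphism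
`FreeGroup ℕ →* SU(2)`, `n ↦ A^{n+1} B A^{n+1}`, is injective. [folklore] -/
theorem lift_genNat_injective : Function.Injective (FreeGroup.lift genNat) := by
  rw [injective_iff_map_eq_one]
  intro g hg
  by_contra hne
  have hW : g.toWord ≠ [] := by rwa [Ne, FreeGroup.toWord_eq_nil_iff]
  have hlift := FreeGroup.lift_mk (f := genNat) (L := g.toWord)
  rw [FreeGroup.mk_toWord, hg] at hlift
  exact prod_valNat_ne_one hW FreeGroup.isReduced_toWord hlift.symm

/-- The word form of injectivity: a REDUCED word in the `g_n^{±1}` evaluates to `1` iff it is empty.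
[folklore] -/
theorem prod_valNat_eq_one_iff {W : List (ℕ × Bool)} (h : FreeGroup.IsReduced W) : (W.map valNat).prod = 1 ↔ W = [] := by
  refine ⟨fun h1 => ?_, fun h0 => by simp [h0]⟩
  by_contra hW
  exact prod_valNat_ne_one hW h h1

/-- **Reduced words are separated**: two REDUCED words in the `g_n^{±1}` with the same value are equal.
[folklore] -/
theorem eq_of_prod_valNat_eq {W W' : List (ℕ × Bool)} (h : FreeGroup.IsReduced W) (h' : FreeGroup.IsReduced W')
    (e : (W.map valNat).prod = (W'.map valNat).prod) : W = W' := by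
  have hmk : FreeGroup.mk W = FreeGroup.mk W' := by
    apply lift_genNat_injective
    rw [FreeGroup.lift_mk, FreeGroup.lift_mk]
    exact e
  have := congrArg FreeGroup.toWord hmk
  rwa [FreeGroup.toWord_mk, FreeGroup.toWord_mk, h.reduce_eq, h'.reduce_eq] at this

end FreeSU2

end Summit.QuantumFields.GaugeBoot

end
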